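import Summits.BirchSwinnertonDyer.Rank1Residual.Additive.BudgetFromTamagawaWitnessesLayer
import Summits.BirchSwinnertonDyer.Rank1Residual.Additive.PlacesOverFinset
import Summits.BirchSwinnertonDyer.Rank1Residual.Additive.TamagawaWitnessesLayer
import Summits.BirchSwinnertonDyer.Rank1Residual.Additive.ZpTowerPlaceCount
import HarnessLib

/-!
# The Route-G budget at level `n` from CENSUS CERTIFICATES over `ℚ` (row T-E3g-BUDn-CERT,
# FILE 2b: the assembly; seat p10 GEN 5 — FILE 1 = n1011-p01 GEN 3, FILE 2a =
# `TamagawaWitnessesLayer`)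

HONEST FRAMING (cell `b2b-bsdres`, run/shared/lean/b2b/bsd-rank1-residual/, verbatim in every
file): the goal of the cell is to DELETE the COMBINATION-SHAPED residual classes of the
Birch–Swinnerton-Dyer formula for ALL analytic-rank `≤ 1` elliptic curves over `ℚ` — "full BSD
formula for every rank `≤ 1` curve in class `C`" assembled STRICTLY from published theorems — so
that the rank-`≤ 1` remainder becomes exactly the CONSTRUCTION-SHAPED classes, which are TYPED
(missing-input `Prop`s), NOT attempted. This is not "finishing BSD". Team n1011 (N10/N11, the
Route-G LOWER budget node of the CONSTRUCTION-SHAPED classes X3♯/X4♯): research route; nothing is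
booked by this file; no mark / label moved. THEOREMS ONLY: no definition, no named fact, no
`sorry`; census certificates enter as HYPOTHESES per row, never as facts.

## What (ROUTE-2 II.17.3 D-n.1 – D-n.3 assembled; p10 GEN 4 HANDOFF item N4)

Row T-E3g-BUDn landed `budgetLeLambdaAt_layer_of_tamagawaWitnesses` (N2): for an odd prime `p`
with `p ∤ #E(ℚ)_tors` and a level `n`, `BudgetLeLambdaAt p W b` follows from — besides the named
facts (Greenberg 4.14, Poitou–Tate / local Euler–Poincaré over `ℚ_n`) and the restricted tower
with its Selmer transport (`hres`, row T-res, n1011-p17) — a WITNESS hypothesis `hwitn`: over the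
layer `ℚ_n = κ.layer n` of every cyclotomic `κ`, `b` places `w ∤ p` each carrying
`∃ u ∈ H¹_ur((ℚ_n)_w, E[p]), u ∉ 𝓚_w`. THIS FILE discharges `hwitn` and `b` from data OVER `ℚ`:

* §1 `budgetLeLambdaAt_layer_of_placesOver` — N2 with `hwitn` replaced by PER-PLACE data over
  `ℚ`: a finite set `S` of places `v ∤ p`, lower bounds `c v ≤ #{w ∣ v in ℚ_n}` and a witness at
  every `w ∣ v` (glue `exists_finset_placesOver_card_ge`): `BudgetLeLambdaAt p W (Σ_{v ∈ S} c v)`;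
* §2 `budgetLeLambdaAt_layer_of_padicValNat` — `c v = p^{min(n, m_v)}` from the PLACE-COUNT
  certificate `v_p(N(v)^{p−1} − 1) = m_v + 1` (n1011-p01 FILE 4
  `card_placesOver_layer_mul_pow_eq_rat_of_padicValNat`, r2 D-n.1);
* §3 `budgetLeLambdaAt_layer_of_additiveCertificates` — the ADDITIVE rows assembled:
  `BudgetLeLambdaAt p W (Σ_{v ∈ S} p^{min(n, m_v)})` from `(v ∤ p, m_v, additive at v, p ∣ c_v)`
  per `v ∈ S` (FILE 2a's additive layer witness), modulo exactly N2's binders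
  `h414 / hres / hPT / hEP` — no A40; the mixed additive + split-multiplicative form
  `…_of_certificates` (A40 + FILE 1's layer `hμ` from `ℓ ≢ 1 (mod p)`) lands in the sequel file.
Residual-count (`ResidualSelmerRankGeAt`) twins throughout.

HONEST LIMITS: one inequality per layer `n` (as N2); `hres` stays a binder until row T-res lands;
split multiplicative `ℓ ≡ 1 (mod p)` rows are NOT covered ((L1), n1011-p14); non-split
multiplicative `ℓ` never has `p ∣ c_ℓ` for odd `p`; additive rows with `p ∤ c_ℓ` give no witness.
For `n ≥ max_v m_v` the sum is `Σ_v p^{m_v}`, the certified part of r2's `B(E,p)` (ST-17.5,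
EVIDENCE).

References: R. Greenberg, LNM 1716 (1999) §5 pp. 114–118 (proof of Cor. 5.6, the example 406D1)
and Prop. 4.14 [GreenbergLNM1716]; K. Matsuno, Manuscripta Math. 122 (2007) Lemma 3.5, §4;
L. C. Washington, *Introduction to Cyclotomic Fields* §13.1 [Washington1997]; ROUTE-2 II.17
(cells/n1011/).
-/


set_option autoImplicit false

noncomputable section

open scoped Classical

open Function Field NumberField IsDedekindDomain WeierstrassCurve
open Literature.NumberTheory.EllipticCurves Literature.NumberTheory.GaloisRepresentations
open Literature.NumberTheory.GaloisRepresentations.DiscreteGaloisModule (unramifiedSubgroup)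
open Literature.NumberTheory.GaloisCohomology

namespace Summit.BirchSwinnertonDyer.Rank1Residual.Additive

/-! ### §1 The budget at level `n` from per-place data over `ℚ` -/

section Assembly

variable {W : WeierstrassCurve ℚ} [W.IsElliptic] [W.IsGloballyMinimal] {p : ℕ} [hp : Fact p.Prime]

/-- **N2 with `hwitn` replaced by per-place data over `ℚ`.** Let `p` be odd with
`p ∤ #E(ℚ)_tors`, `n : ℕ`, `S` a finite set of places `v ∤ p` of `ℚ`; suppose that over the layer
`ℚ_n` of every cyclotomic `κ` each `v ∈ S` has at least `c v` places above it, every one of which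
carries a Tamagawa witness.  Then, modulo N2's binders (`h414`, `hres`, `hPT`, `hEP`):
`BudgetLeLambdaAt p W (Σ_{v ∈ S} c v)`. [cite: GreenbergLNM1716, §5 pp. 114–118 and Prop. 4.14] -/
theorem budgetLeLambdaAt_layer_of_placesOver (hodd : p ≠ 2)
    (h414 : Greenberg1999.prop414_noFiniteSubmodule_of_not_dvd_torsionOrder)
    (htors : ¬ p ∣ W.torsionOrder) (n : ℕ)
    (hres : ∀ (κ : ZpExtension ℚ p) [NumberField (κ.layer n)], κ.IsCyclotomic →
      ∃ κ' : ZpExtension (κ.layer n) p,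
        (∀ σ : absoluteGaloisGroup (κ.layer n),
          (κ' σ).toAdd * (p : ℤ_[p]) ^ n = (κ (resGal (K := ℚ) (κ.layer n) σ)).toAdd) ∧
        ∃ f : (W.baseChange (κ.layer n)).selmerInfty κ' →+ W.selmerInfty κ, Injective f)
    (hPT : ∀ (κ : ZpExtension ℚ p) [NumberField (κ.layer n)], κ.IsCyclotomic →
      poitouTate_selmerStructure_duality (κ.layer n))
    (hEP : ∀ (κ : ZpExtension ℚ p) [NumberField (κ.layer n)], κ.IsCyclotomic →
      ∀ w : HeightOneSpectrum (𝓞 (κ.layer n)),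
      localEulerPoincareCharacteristic (w.adicCompletion (κ.layer n)))
    (S : Finset (HeightOneSpectrum (𝓞 ℚ))) (c : HeightOneSpectrum (𝓞 ℚ) → ℕ)
    (hSp : ∀ v ∈ S, ((p : ℕ) : 𝓞 ℚ) ∉ v.asIdeal)
    (hc : ∀ v ∈ S, ∀ κ : ZpExtension ℚ p, κ.IsCyclotomic →
      c v ≤ Nat.card {w : HeightOneSpectrum (𝓞 (κ.layer n)) // w.under (𝓞 ℚ) = v})
    (hwit : ∀ v ∈ S, ∀ κ : ZpExtension ℚ p, κ.IsCyclotomic →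
      ∀ w : HeightOneSpectrum (𝓞 (κ.layer n)), w.under (𝓞 ℚ) = v →
        ∃ u ∈ unramifiedSubgroup
            (((W.baseChange (κ.layer n)).torsionGaloisModule (p : ℤ)).restrictField
              (w.adicCompletion (κ.layer n))) 1,
          u ∉ (W.baseChange (κ.layer n)).kummerLocalConditionAt (p : ℤ)
            (w.adicCompletion (κ.layer n))) :
    BudgetLeLambdaAt p W (∑ v ∈ S, c v) := by
  refine budgetLeLambdaAt_layer_of_tamagawaWitnesses hodd h414 htors n _ hres hPT hEP
    fun κ _ hκ ↦ ?_
  obtain ⟨T₀, hcard, hP⟩ := exists_finset_placesOver_card_ge S c (fun v hv ↦ hc v hv κ hκ)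
    (fun w ↦ ((p : ℕ) : 𝓞 (κ.layer n)) ∉ w.asIdeal ∧
      ∃ u ∈ unramifiedSubgroup
          (((W.baseChange (κ.layer n)).torsionGaloisModule (p : ℤ)).restrictField
            (w.adicCompletion (κ.layer n))) 1,
        u ∉ (W.baseChange (κ.layer n)).kummerLocalConditionAt (p : ℤ)
          (w.adicCompletion (κ.layer n)))
    (fun v hv w hw ↦ ⟨natCast_not_mem_asIdeal_of_under_eq (hSp v hv) w hw, hwit v hv κ hκ w hw⟩)
  exact ⟨T₀, hcard, fun w hw ↦ (hP w hw).1, fun w hw ↦ (hP w hw).2⟩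

/-- The residual-count twin of `budgetLeLambdaAt_layer_of_placesOver` (same per-place data, plus
finiteness of `Sel_{p^∞}(E/ℚ_∞)[p]`): `ResidualSelmerRankGeAt p W (Σ_{v ∈ S} c v)`.
[cite: GreenbergLNM1716, §5 pp. 114–118] -/
theorem residualSelmerRankGeAt_layer_of_placesOver (hodd : p ≠ 2)
    (htors : ¬ p ∣ W.torsionOrder) (n : ℕ)
    (hfin : ∀ (κ : ZpExtension ℚ p), κ.IsCyclotomic → Finite {s : W.selmerInfty κ // p • s = 0})
    (hres : ∀ (κ : ZpExtension ℚ p) [NumberField (κ.layer n)], κ.IsCyclotomic →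
      ∃ κ' : ZpExtension (κ.layer n) p,
        (∀ σ : absoluteGaloisGroup (κ.layer n),
          (κ' σ).toAdd * (p : ℤ_[p]) ^ n = (κ (resGal (K := ℚ) (κ.layer n) σ)).toAdd) ∧
        ∃ f : (W.baseChange (κ.layer n)).selmerInfty κ' →+ W.selmerInfty κ, Injective f)
    (hPT : ∀ (κ : ZpExtension ℚ p) [NumberField (κ.layer n)], κ.IsCyclotomic →
      poitouTate_selmerStructure_duality (κ.layer n))
    (hEP : ∀ (κ : ZpExtension ℚ p) [NumberField (κ.layer n)], κ.IsCyclotomic →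
      ∀ w : HeightOneSpectrum (𝓞 (κ.layer n)),
      localEulerPoincareCharacteristic (w.adicCompletion (κ.layer n)))
    (S : Finset (HeightOneSpectrum (𝓞 ℚ))) (c : HeightOneSpectrum (𝓞 ℚ) → ℕ)
    (hSp : ∀ v ∈ S, ((p : ℕ) : 𝓞 ℚ) ∉ v.asIdeal)
    (hc : ∀ v ∈ S, ∀ κ : ZpExtension ℚ p, κ.IsCyclotomic →
      c v ≤ Nat.card {w : HeightOneSpectrum (𝓞 (κ.layer n)) // w.under (𝓞 ℚ) = v})
    (hwit : ∀ v ∈ S, ∀ κ : ZpExtension ℚ p, κ.IsCyclotomic →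
      ∀ w : HeightOneSpectrum (𝓞 (κ.layer n)), w.under (𝓞 ℚ) = v →
        ∃ u ∈ unramifiedSubgroup
            (((W.baseChange (κ.layer n)).torsionGaloisModule (p : ℤ)).restrictField
              (w.adicCompletion (κ.layer n))) 1,
          u ∉ (W.baseChange (κ.layer n)).kummerLocalConditionAt (p : ℤ)
            (w.adicCompletion (κ.layer n))) :
    ResidualSelmerRankGeAt p W (∑ v ∈ S, c v) := by
  refine residualSelmerRankGeAt_layer_of_tamagawaWitnesses hodd htors n _ hfin hres hPT hEP
    fun κ _ hκ ↦ ?_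
  obtain ⟨T₀, hcard, hP⟩ := exists_finset_placesOver_card_ge S c (fun v hv ↦ hc v hv κ hκ)
    (fun w ↦ ((p : ℕ) : 𝓞 (κ.layer n)) ∉ w.asIdeal ∧
      ∃ u ∈ unramifiedSubgroup
          (((W.baseChange (κ.layer n)).torsionGaloisModule (p : ℤ)).restrictField
            (w.adicCompletion (κ.layer n))) 1,
        u ∉ (W.baseChange (κ.layer n)).kummerLocalConditionAt (p : ℤ)
          (w.adicCompletion (κ.layer n)))
    (fun v hv w hw ↦ ⟨natCast_not_mem_asIdeal_of_under_eq (hSp v hv) w hw, hwit v hv κ hκ w hw⟩)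
  exact ⟨T₀, hcard, fun w hw ↦ (hP w hw).1, fun w hw ↦ (hP w hw).2⟩

/-! ### §2 The place-count certificate: `c v = p^{min(n, m_v)}` -/

/-- From the PLACE-COUNT certificate `v_p(N(v)^{p−1} − 1) = m + 1` (`p` odd, `v ∤ p`, `κ`
cyclotomic): `#{w ∣ v in ℚ_n} = p^{min(n, m)}` (n1011-p01's
`card_placesOver_layer_mul_pow_eq_rat_of_padicValNat`, r2 D-n.1). [cite: Washington1997, §13.1] -/
theorem pow_min_eq_natCard_placesOver_layer (κ : ZpExtension ℚ p) (hκ : κ.IsCyclotomic)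
    (hp2 : p ≠ 2) (n : ℕ) {v : HeightOneSpectrum (𝓞 ℚ)} (hv : ((p : ℕ) : 𝓞 ℚ) ∉ v.asIdeal)
    {m : ℕ} (hval : padicValNat p (v.residueCard ^ (p - 1) - 1) = m + 1) :
    p ^ min n m = Nat.card {w : HeightOneSpectrum (𝓞 (κ.layer n)) // w.under (𝓞 ℚ) = v} := by
  have h := ZpTower.card_placesOver_layer_mul_pow_eq_rat_of_padicValNat κ n hκ hp2 hv hval
  have hmin : p ^ min n m * p ^ (n - m) = p ^ n := by
    rw [← pow_add]; congr 1; omega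
  rw [← hmin] at h
  exact (Nat.eq_of_mul_eq_mul_right (pow_pos hp.out.pos _) h).symm

/-- **The budget at level `n` with the place count certified.** As
`budgetLeLambdaAt_layer_of_placesOver`, with `c v = p^{min(n, m_v)}` read off the certificate
`v_p(N(v)^{p−1} − 1) = m_v + 1` at each `v ∈ S`:
`BudgetLeLambdaAt p W (Σ_{v ∈ S} p^{min(n, m_v)})`. [cite: GreenbergLNM1716, §5 pp. 114–118 and Prop. 4.14]
[cite: Washington1997, §13.1] -/
theorem budgetLeLambdaAt_layer_of_padicValNat (hodd : p ≠ 2)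
    (h414 : Greenberg1999.prop414_noFiniteSubmodule_of_not_dvd_torsionOrder)
    (htors : ¬ p ∣ W.torsionOrder) (n : ℕ)
    (hres : ∀ (κ : ZpExtension ℚ p) [NumberField (κ.layer n)], κ.IsCyclotomic →
      ∃ κ' : ZpExtension (κ.layer n) p,
        (∀ σ : absoluteGaloisGroup (κ.layer n),
          (κ' σ).toAdd * (p : ℤ_[p]) ^ n = (κ (resGal (K := ℚ) (κ.layer n) σ)).toAdd) ∧
        ∃ f : (W.baseChange (κ.layer n)).selmerInfty κ' →+ W.selmerInfty κ, Injective f)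
    (hPT : ∀ (κ : ZpExtension ℚ p) [NumberField (κ.layer n)], κ.IsCyclotomic →
      poitouTate_selmerStructure_duality (κ.layer n))
    (hEP : ∀ (κ : ZpExtension ℚ p) [NumberField (κ.layer n)], κ.IsCyclotomic →
      ∀ w : HeightOneSpectrum (𝓞 (κ.layer n)),
      localEulerPoincareCharacteristic (w.adicCompletion (κ.layer n)))
    (S : Finset (HeightOneSpectrum (𝓞 ℚ))) (m : HeightOneSpectrum (𝓞 ℚ) → ℕ)
    (hSp : ∀ v ∈ S, ((p : ℕ) : 𝓞 ℚ) ∉ v.asIdeal)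
    (hval : ∀ v ∈ S, padicValNat p (v.residueCard ^ (p - 1) - 1) = m v + 1)
    (hwit : ∀ v ∈ S, ∀ κ : ZpExtension ℚ p, κ.IsCyclotomic →
      ∀ w : HeightOneSpectrum (𝓞 (κ.layer n)), w.under (𝓞 ℚ) = v →
        ∃ u ∈ unramifiedSubgroup
            (((W.baseChange (κ.layer n)).torsionGaloisModule (p : ℤ)).restrictField
              (w.adicCompletion (κ.layer n))) 1,
          u ∉ (W.baseChange (κ.layer n)).kummerLocalConditionAt (p : ℤ)
            (w.adicCompletion (κ.layer n))) :
    BudgetLeLambdaAt p W (∑ v ∈ S, p ^ min n (m v)) :=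
  budgetLeLambdaAt_layer_of_placesOver hodd h414 htors n hres hPT hEP S (fun v ↦ p ^ min n (m v))
    hSp (fun v hv κ hκ ↦ (pow_min_eq_natCard_placesOver_layer κ hκ hodd n (hSp v hv) (hval v hv)).le)
    hwit

/-- The residual-count twin of `budgetLeLambdaAt_layer_of_padicValNat`.
[cite: GreenbergLNM1716, §5 pp. 114–118] [cite: Washington1997, §13.1] -/
theorem residualSelmerRankGeAt_layer_of_padicValNat (hodd : p ≠ 2)
    (htors : ¬ p ∣ W.torsionOrder) (n : ℕ)
    (hfin : ∀ (κ : ZpExtension ℚ p), κ.IsCyclotomic → Finite {s : W.selmerInfty κ // p • s = 0})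
    (hres : ∀ (κ : ZpExtension ℚ p) [NumberField (κ.layer n)], κ.IsCyclotomic →
      ∃ κ' : ZpExtension (κ.layer n) p,
        (∀ σ : absoluteGaloisGroup (κ.layer n),
          (κ' σ).toAdd * (p : ℤ_[p]) ^ n = (κ (resGal (K := ℚ) (κ.layer n) σ)).toAdd) ∧
        ∃ f : (W.baseChange (κ.layer n)).selmerInfty κ' →+ W.selmerInfty κ, Injective f)
    (hPT : ∀ (κ : ZpExtension ℚ p) [NumberField (κ.layer n)], κ.IsCyclotomic →
      poitouTate_selmerStructure_duality (κ.layer n))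
    (hEP : ∀ (κ : ZpExtension ℚ p) [NumberField (κ.layer n)], κ.IsCyclotomic →
      ∀ w : HeightOneSpectrum (𝓞 (κ.layer n)),
      localEulerPoincareCharacteristic (w.adicCompletion (κ.layer n)))
    (S : Finset (HeightOneSpectrum (𝓞 ℚ))) (m : HeightOneSpectrum (𝓞 ℚ) → ℕ)
    (hSp : ∀ v ∈ S, ((p : ℕ) : 𝓞 ℚ) ∉ v.asIdeal)
    (hval : ∀ v ∈ S, padicValNat p (v.residueCard ^ (p - 1) - 1) = m v + 1)
    (hwit : ∀ v ∈ S, ∀ κ : ZpExtension ℚ p, κ.IsCyclotomic →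
      ∀ w : HeightOneSpectrum (𝓞 (κ.layer n)), w.under (𝓞 ℚ) = v →
        ∃ u ∈ unramifiedSubgroup
            (((W.baseChange (κ.layer n)).torsionGaloisModule (p : ℤ)).restrictField
              (w.adicCompletion (κ.layer n))) 1,
          u ∉ (W.baseChange (κ.layer n)).kummerLocalConditionAt (p : ℤ)
            (w.adicCompletion (κ.layer n))) :
    ResidualSelmerRankGeAt p W (∑ v ∈ S, p ^ min n (m v)) :=
  residualSelmerRankGeAt_layer_of_placesOver hodd htors n hfin hres hPT hEP S
    (fun v ↦ p ^ min n (m v)) hSp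
    (fun v hv κ hκ ↦ (pow_min_eq_natCard_placesOver_layer κ hκ hodd n (hSp v hv) (hval v hv)).le)
    hwit

/-! ### §3 The additive rows assembled -/

/-- **The Route-G budget at level `n` from ADDITIVE Tamagawa certificates over `ℚ`.** Let
`E = W/ℚ` be globally minimal, `p` an odd prime with `p ∤ #E(ℚ)_tors`, `n : ℕ`, and `S` a finite
set of places `v` of `ℚ`, each with: `v ∤ p`, a place-count certificate
`v_p(N(v)^{p−1} − 1) = m_v + 1`, ADDITIVE reduction of `E` at `v`, and `p ∣ c_v`.  Then, modulo
exactly the binders of N2 (`h414` Greenberg 4.14; `hres` the restricted tower with its Selmer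
transport, row T-res; `hPT` / `hEP` Poitou–Tate and local Euler–Poincaré over `ℚ_n`):
`BudgetLeLambdaAt p W (Σ_{v ∈ S} p^{min(n, m_v)})` — N2's `hwitn` and `b` DISCHARGED from census
data (r2 II.17.3 D-n.1 + D-n.3 (add); for `n ≥ max m_v` the sum is `Σ_v p^{m_v}`, the additive
part of `B(E,p)`).  No A40. [cite: GreenbergLNM1716, §5 pp. 114–118 and Prop. 4.14]
[cite: Washington1997, §13.1 and Prop. 13.2] -/
theorem budgetLeLambdaAt_layer_of_additiveCertificates (hodd : p ≠ 2)
    (h414 : Greenberg1999.prop414_noFiniteSubmodule_of_not_dvd_torsionOrder)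
    (htors : ¬ p ∣ W.torsionOrder) (n : ℕ)
    (hres : ∀ (κ : ZpExtension ℚ p) [NumberField (κ.layer n)], κ.IsCyclotomic →
      ∃ κ' : ZpExtension (κ.layer n) p,
        (∀ σ : absoluteGaloisGroup (κ.layer n),
          (κ' σ).toAdd * (p : ℤ_[p]) ^ n = (κ (resGal (K := ℚ) (κ.layer n) σ)).toAdd) ∧
        ∃ f : (W.baseChange (κ.layer n)).selmerInfty κ' →+ W.selmerInfty κ, Injective f)
    (hPT : ∀ (κ : ZpExtension ℚ p) [NumberField (κ.layer n)], κ.IsCyclotomic →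
      poitouTate_selmerStructure_duality (κ.layer n))
    (hEP : ∀ (κ : ZpExtension ℚ p) [NumberField (κ.layer n)], κ.IsCyclotomic →
      ∀ w : HeightOneSpectrum (𝓞 (κ.layer n)),
      localEulerPoincareCharacteristic (w.adicCompletion (κ.layer n)))
    (S : Finset (HeightOneSpectrum (𝓞 ℚ))) (m : HeightOneSpectrum (𝓞 ℚ) → ℕ)
    (hSp : ∀ v ∈ S, ((p : ℕ) : 𝓞 ℚ) ∉ v.asIdeal)
    (hval : ∀ v ∈ S, padicValNat p (v.residueCard ^ (p - 1) - 1) = m v + 1)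
    (hadd : ∀ v ∈ S, W.HasAdditiveReductionAt v)
    (hcv : ∀ v ∈ S,
      p ∣ (W.baseChange (v.adicCompletion ℚ)).localTamagawaNumber (v.adicCompletionIntegers ℚ)) :
    BudgetLeLambdaAt p W (∑ v ∈ S, p ^ min n (m v)) :=
  budgetLeLambdaAt_layer_of_padicValNat hodd h414 htors n hres hPT hEP S m hSp hval
    fun v hv κ _ w hw ↦
      exists_mem_unramifiedSubgroup_not_mem_kummerLocalConditionAt_layer_of_hasAdditiveReductionAt
        W κ n (hSp v hv) hodd (hadd v hv) (hcv v hv) w hw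

/-- The residual-count twin of `budgetLeLambdaAt_layer_of_additiveCertificates`:
`ResidualSelmerRankGeAt p W (Σ_{v ∈ S} p^{min(n, m_v)})` (plus finiteness of
`Sel_{p^∞}(E/ℚ_∞)[p]`). [cite: GreenbergLNM1716, §5 pp. 114–118] [cite: Washington1997, §13.1] -/
theorem residualSelmerRankGeAt_layer_of_additiveCertificates (hodd : p ≠ 2)
    (htors : ¬ p ∣ W.torsionOrder) (n : ℕ)
    (hfin : ∀ (κ : ZpExtension ℚ p), κ.IsCyclotomic → Finite {s : W.selmerInfty κ // p • s = 0})
    (hres : ∀ (κ : ZpExtension ℚ p) [NumberField (κ.layer n)], κ.IsCyclotomic →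
      ∃ κ' : ZpExtension (κ.layer n) p,
        (∀ σ : absoluteGaloisGroup (κ.layer n),
          (κ' σ).toAdd * (p : ℤ_[p]) ^ n = (κ (resGal (K := ℚ) (κ.layer n) σ)).toAdd) ∧
        ∃ f : (W.baseChange (κ.layer n)).selmerInfty κ' →+ W.selmerInfty κ, Injective f)
    (hPT : ∀ (κ : ZpExtension ℚ p) [NumberField (κ.layer n)], κ.IsCyclotomic →
      poitouTate_selmerStructure_duality (κ.layer n))
    (hEP : ∀ (κ : ZpExtension ℚ p) [NumberField (κ.layer n)], κ.IsCyclotomic →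
      ∀ w : HeightOneSpectrum (𝓞 (κ.layer n)),
      localEulerPoincareCharacteristic (w.adicCompletion (κ.layer n)))
    (S : Finset (HeightOneSpectrum (𝓞 ℚ))) (m : HeightOneSpectrum (𝓞 ℚ) → ℕ)
    (hSp : ∀ v ∈ S, ((p : ℕ) : 𝓞 ℚ) ∉ v.asIdeal)
    (hval : ∀ v ∈ S, padicValNat p (v.residueCard ^ (p - 1) - 1) = m v + 1)
    (hadd : ∀ v ∈ S, W.HasAdditiveReductionAt v)
    (hcv : ∀ v ∈ S,
      p ∣ (W.baseChange (v.adicCompletion ℚ)).localTamagawaNumber (v.adicCompletionIntegers ℚ)) :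
    ResidualSelmerRankGeAt p W (∑ v ∈ S, p ^ min n (m v)) :=
  residualSelmerRankGeAt_layer_of_padicValNat hodd htors n hfin hres hPT hEP S m hSp hval
    fun v hv κ _ w hw ↦
      exists_mem_unramifiedSubgroup_not_mem_kummerLocalConditionAt_layer_of_hasAdditiveReductionAt
        W κ n (hSp v hv) hodd (hadd v hv) (hcv v hv) w hw

end Assembly

end Summit.BirchSwinnertonDyer.Rank1Residual.Additive

end
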